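import Literature.NumberTheory.LFunctions.FiniteTypeInequalities

/-!
# [CV] Lemma 3.4, comparison form: local summability from one bounded class-weighted sum

Companion of `FiniteTypeInequalities.lean` (2001 magnification programme, archive `2001`: [CV] Lemma 3.4 "`B_q < ∞`",
W-MAG §3).  The finite weighted type inequality delivered by the comb evaluation of the crux line
`Summits/RiemannHypothesis/RiemannHypothesis/Cruxes/ConeMagnification` (`COMB-EVALUATION.md` (TI_M), §5(b)) for the
2-point design `δ₁ + tδ_p` carries CLASS-DEPENDENT cut-off weights: on the multiples of `p` the weight is
`V_M(n) = (t/√p)(p·w⁴_M(n) − w²_M(n))` with `w² ≤ w⁴` two log-Riesz weights (`LogRieszWeights.lean`,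
`logRiesz_anti_right`), plus secondary sharp-cut-off terms of size `O(1/log M)` and either sign.  The arithmetic
tail of §5(b) is therefore the following comparison form of `summable_local_of_twoPoint_bound`, PROVED here:
`summable_local_of_weighted_bound` — if `B·w_i ≤ v_i + e_i` with `w_i ≥ 0` regular (`→ 1` pointwise, vanishing from
`N i` on), `|v_i| ≤ V`, the error weight `e_i` has eventually bounded `c`-mass on the multiples of `p` (Chebyshev for
`c` on the top window), and eventually `∑_{n<N i, p∣n} ((c−Λ)(n)/n) v_i(n) ≤ K`, then `∑_{p∣n} c(n)/n < ∞` — the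
conclusion of the crux stub `stub_combLocal`, verbatim.  [folklore]
-/

noncomputable section

open scoped BigOperators ComplexConjugate Classical
open Filter Finset ArithmeticFunction
open _root_.Topology

namespace Literature.NumberTheory.LFunctions

namespace TypeDesign

open GcdForm

/-! ### [CV] Lemma 3.4, comparison form: class-dependent weights with a cut-off error -/

/-- **Local summability from one bounded weighted sum over the multiples of `p` (comparison form of [CV]
Lemma 3.4).**  Let `c ≥ 0`, `p` prime, `w_i ≥ 0` regular cut-off weights (`w_i(n) → 1` pointwise along a
nontrivial filter, `w_i` vanishing from `N i` on), and `v_i` the actual (class-dependent, possibly signed near the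
cut-off) weights on the multiples of `p`, with `B·w_i ≤ v_i + e_i` for some `B > 0` and an error weight `e_i` whose
`c`-mass `∑_{n<N i, p∣n} (c(n)/n) e_i(n)` is eventually `≤ E` (e.g. `e_i = O(1/log M)` on a window `X/e^a < n ≤ X`,
by Chebyshev for `c`), and `|v_i| ≤ V`.  If eventually `∑_{n<N i, p∣n} ((c−Λ)(n)/n)·v_i(n) ≤ K`, then
`∑_{p∣n} c(n)/n < ∞` — the conclusion of the crux stub `stub_combLocal`.  (Add back the summable `Λ`-part, compare,
Fatou `summable_of_sum_mul_weight_le`.) [folklore] -/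
theorem summable_local_of_weighted_bound {c : ℕ → ℝ} (hc : ∀ n, 0 ≤ c n) {p : ℕ} (hp : p.Prime)
    {ι : Type*} {l : Filter ι} [l.NeBot] (v w e : ι → ℕ → ℝ) (N : ι → ℕ)
    (hw_one : ∀ n, Tendsto (fun i => w i n) l (𝓝 1)) (hw_nonneg : ∀ᶠ i in l, ∀ n, 0 ≤ w i n)
    (hw_zero : ∀ᶠ i in l, ∀ n, N i ≤ n → w i n = 0)
    {B V E K : ℝ} (hB : 0 < B)
    (hvw : ∀ᶠ i in l, ∀ n, B * w i n ≤ v i n + e i n) (hvV : ∀ᶠ i in l, ∀ n, |v i n| ≤ V)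
    (he : ∀ᶠ i in l, ∑ n ∈ Finset.range (N i), (if p ∣ n then c n / n else 0) * e i n ≤ E)
    (hK : ∀ᶠ i in l, ∑ n ∈ Finset.range (N i),
      (if p ∣ n then (c n - Λ n) / n else 0) * v i n ≤ K) :
    Summable fun n : ℕ => if p ∣ n then c n / n else 0 := by
  have hΛ := summable_vonMangoldt_div_of_dvd hp
  have hΛ0 : ∀ n, 0 ≤ (if p ∣ n then (Λ n : ℝ) / n else 0) := fun n => by
    split_ifs
    · exact div_nonneg vonMangoldt_nonneg (Nat.cast_nonneg _)
    · exact le_rfl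
  set SΛ : ℝ := ∑' n, (if p ∣ n then (Λ n : ℝ) / n else 0) with hSΛ
  have hf : ∀ n, 0 ≤ (if p ∣ n then c n / n else 0 : ℝ) := fun n => by
    split_ifs
    · exact div_nonneg (hc n) (Nat.cast_nonneg _)
    · exact le_rfl
  refine (summable_of_sum_mul_weight_le hf w hw_one (B := (K + V * SΛ + E) / B) fun K₀ => ?_).1
  filter_upwards [hK, hvw, hvV, he, hw_nonneg, hw_zero] with i hKi hvwi hvVi hei hwi hzi
  -- (a) add back the `Λ`-part: the `c`-part over the multiples of `p`, weighted by `v`, is bounded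
  have step1 : ∑ n ∈ Finset.range (N i), (if p ∣ n then c n / n else 0) * v i n ≤ K + V * SΛ := by
    have hsplit : ∀ n, (if p ∣ n then c n / n else 0 : ℝ) * v i n =
        (if p ∣ n then (c n - Λ n) / n else 0) * v i n + (if p ∣ n then (Λ n : ℝ) / n else 0) * v i n := by
      intro n
      split_ifs <;> ring
    rw [Finset.sum_congr rfl fun n _ => hsplit n, Finset.sum_add_distrib]
    refine add_le_add hKi ?_
    calc ∑ n ∈ Finset.range (N i), (if p ∣ n then (Λ n : ℝ) / n else 0) * v i n
        ≤ ∑ n ∈ Finset.range (N i), (if p ∣ n then (Λ n : ℝ) / n else 0) * V :=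
          Finset.sum_le_sum fun n _ =>
            mul_le_mul_of_nonneg_left ((le_abs_self _).trans (hvVi n)) (hΛ0 n)
      _ = V * ∑ n ∈ Finset.range (N i), (if p ∣ n then (Λ n : ℝ) / n else 0) := by
          rw [← Finset.sum_mul, mul_comm]
      _ ≤ V * SΛ :=
          mul_le_mul_of_nonneg_left (hΛ.sum_le_tsum _ fun n _ => hΛ0 n) ((abs_nonneg _).trans (hvVi 0))
  -- (b) compare `B·w ≤ v + e` on the full support of `w`
  have step2 : B * ∑ n ∈ Finset.range K₀, (if p ∣ n then c n / n else 0) * w i n ≤ K + V * SΛ + E := by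
    calc B * ∑ n ∈ Finset.range K₀, (if p ∣ n then c n / n else 0) * w i n
        ≤ B * ∑ n ∈ Finset.range (max K₀ (N i)), (if p ∣ n then c n / n else 0) * w i n := by
          refine mul_le_mul_of_nonneg_left ?_ hB.le
          exact Finset.sum_le_sum_of_subset_of_nonneg (Finset.range_mono (le_max_left _ _))
            fun n _ _ => mul_nonneg (hf n) (hwi n)
      _ = B * ∑ n ∈ Finset.range (N i), (if p ∣ n then c n / n else 0) * w i n := by
          congr 1
          symm
          refine Finset.sum_subset (Finset.range_mono (le_max_right _ _)) fun n _ hn' => ?_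
          have hNn : N i ≤ n := by simpa using hn'
          rw [hzi n hNn, mul_zero]
      _ = ∑ n ∈ Finset.range (N i), (if p ∣ n then c n / n else 0) * (B * w i n) := by
          rw [Finset.mul_sum]
          refine Finset.sum_congr rfl fun n _ => ?_
          ring
      _ ≤ ∑ n ∈ Finset.range (N i), (if p ∣ n then c n / n else 0) * (v i n + e i n) :=
          Finset.sum_le_sum fun n _ => mul_le_mul_of_nonneg_left (hvwi n) (hf n)
      _ = ∑ n ∈ Finset.range (N i), (if p ∣ n then c n / n else 0) * v i n +
            ∑ n ∈ Finset.range (N i), (if p ∣ n then c n / n else 0) * e i n := by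
          rw [← Finset.sum_add_distrib]
          refine Finset.sum_congr rfl fun n _ => ?_
          ring
      _ ≤ K + V * SΛ + E := add_le_add step1 hei
  rw [le_div_iff₀ hB]
  linarith

end TypeDesign

end Literature.NumberTheory.LFunctions
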